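import Summits.QuantumFields.YangMills.Theorems.BalabanUVNodesN06AtRecord11ObligationsPins
import Summits.QuantumFields.YangMills.Theorems.BalabanUVNodesN06AtRecord11ObligationsHg
import Literature.MathematicalPhysics.QuantumFieldTheory.Balaban1983to89.B9Cor35ComparisonsEH
import Literature.MathematicalPhysics.QuantumFieldTheory.Balaban1983to89.B9Ineq346SecondOrderGpAtLetters
import Literature.MathematicalPhysics.QuantumFieldTheory.Balaban1983to89.B9Ineq347GAAtLetters
import Literature.MathematicalPhysics.QuantumFieldTheory.Balaban1983to89.B9Thm39ReadingAtLetters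
import Literature.MathematicalPhysics.QuantumFieldTheory.Balaban1983to89.B9Thm314Thm315RecordVacuity
import Literature.MathematicalPhysics.QuantumFieldTheory.Balaban1983to89.Node00.OpsYSectDE
import Literature.MathematicalPhysics.QuantumFieldTheory.Balaban1983to89.B9Thm312WholeLeafRelH
import Literature.MathematicalPhysics.QuantumFieldTheory.Balaban1983to89.B9Thm313WholeLeafRel
import Literature.MathematicalPhysics.QuantumFieldTheory.Balaban1983to89.B9Thm312WholeFacesY
import Literature.MathematicalPhysics.QuantumFieldTheory.Balaban1983to89.B9CarrierBlockMultiplicity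
import Literature.MathematicalPhysics.QuantumFieldTheory.Balaban1983to89.B9CoRealizesRelAtLetters

/-!
# BalabanUVNodes ∕ N06 ([B9], `Dag.B9_main`) — THE SOUND CORE OF THE STAGE-11 CERTIFICATE AT def-Y's v3 INSTANCE `opsYOfRecordDE` (THE GENUINE
# Sect.-D LETTERS): rows 20–21 on n06-l's REPAIRED (`CoRealizesRel`) leaves with the carrier-block equivalence DISCHARGED, row 26 on n06-i's ring-inverse face,
# rows 22–23 WHOLE for the genuine `Kdiff`, rows 13 ∕ 18–19 WHOLE until their repaired faces land — no displayed hypothesis is the target of a located negative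

Track A of `YM-PLAN.md` (cell `pub-ymgap`, HUMAN RULING D-0062), node **N06** = [Balaban1985BackgroundPropagators] Thms 3.1–3.15; seat `pub-ymgap-dag-n06-d`
gen 4.  Sequel of `…N06AtOpsYOfRecordSound` (p493596, the sound core at def-Y v2's `opsYOfRecord`) — fired by def-Y g3's FILE 7 `Node00.OpsYSectDE` (p492998:
`opsYOfRecordDE N θ M⋆ 𝔯 𝔈 := opsYOfLetters N θ M⋆ (lettersYOfRecordDE N θ M⋆ 𝔯) 𝔈`, the v3 letters: `GD QGQinv H` = n06-i's genuine `GDY ∕ QGQinvY ∕ HDY`, `G₁ QG1Qinv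
H₁ GG` = `G1Y ∕ QG1QinvY ∕ H1Y ∕ GGY … (𝔯 x).Δ2` over the residual Δ⁽²⁾ family `𝔯 : ResY`, `Kdiff = KdiffY` GENUINE, `P349 Ck` still the flat `0`; `parS parB Gp GA C`
unchanged) and by n06-l g3's repaired leaves `B9Thm312WholeLeafRelH.thm312Printed_of_stepRelH` ∕ `B9Thm313WholeLeafRel.thm313Printed_of_stepRel` (p494117 ∕ p492290).

PER ROW of p449575 `…N06AtRecord11CB10YZW.b9_main_of_up_view₁₁B10YZW_of_obligations` at `ops := opsYOfRecordDE N θ M⋆ 𝔯 𝔈` (every `𝔯`, every `𝔈`):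
* rows 1–8, 9–10, 12 DISCHARGED exactly as in the predecessor (the `…_opsYOfLetters` comparisons ∕ `hE4∕hH2_of_…` ∕ `hGA_opsYOfLetters` at `𝔏 := lettersYOfRecordDE …`);
  row 11 ⇐ `hGpE4 hGpH2` (n06-h g3 `hGp_opsYOfLetters_of_leaves2`); row 14 `hg_obligation_vacuous`; rows 15–16 ⇐ n06-j g5 `t39_hksum_of_pins_opsYOfLetters` (the letter
  `C` of the v3 record is the record's, `hC := rfl`); row 17 ⇐ `t311_of_pin` (PADDED, as before);
* ★ rows 20–21 (`t312 t313`) ⇐ n06-l's `thm312Printed_of_stepRelH` ∕ `thm313Printed_of_stepRel` reading the GENUINE `GD G₁ H H₁ GG` of the v3 record: walk letters `𝔬12`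
  (n06-l's `B9Thm312Whole.Ops`), the numerics, the model schemas `hmodel12 hleft12 hlettersH12 hletters13 hlettersD13`, the residuals `hres12 hres13` ((3.46), (3.43)–(3.45),
  the Hölder member of (3.133)), the pins `hpinE hpinH hpinK`, and the co-readings IN THE REPAIRED SPECIES ONLY: `hcoR12 hco1R12 hcoR13 hco1R13 : CoRealizesRel … (RelB x.toKIdx) …`
  (n06-l `B9CoRealizesRel` p491865 — relative to the carrier-block equivalence `RelB` of `B9CoRealizesRelAtLetters` p492313), `hcoHR12 : CoRealizesHRel … (RelB x.toKIdx) …` (n06-l `B9CoRealizesHRel` p494087), `hcoG12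
  hcoG13 : CoReadsGlob …` (fibre-free).  DISCHARGED HERE at the record: the saturation `hsat` of the (3.42) majorant `maj342 (geo9Y x)` for `RelB` (`maj342_relB_left ∕
  _right`: `len` and `dist` of an index bond are functions of its carrier block) the multiplicity `hmult` with `m := 2(d+1)` (n06-l `B9CarrierBlockMultiplicity.
  card_sameCarrier_le_kIdx` p493027: a carrier block belongs to ≤ 2(d+1) index bonds) and `hRdist`∕`hRlen` (`dist_eq_of_relB`∕`len_eq_of_relB`); `hL21` by `lemma21AboveG_geo9Y` (R := 1), `hrow` by `rowSum261_geo9Y`;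
* ★ rows 22–23 (`t314 t314loc`) DISPLAYED WHOLE — the letter `Kdiff = G(Ω,U) − G(Ω′,U)` is GENUINE at v3 (no vacuity lemma applies; n06-m g3's reading-calculus faces
  `B9Thm314Whole*` are the sequel);
* row 24 (`t315`) and row 25 (`s349`) hold OUTRIGHT BUT VACUOUSLY (the v3 `Ck`, `P349` are the flat `0`, `lettersYOfRecordDE_P349_Ck` — LOCATED (M8) by def-Y): proved inline from
  `thm315FullPrinted_of_ker_zero` + `siteKernelOfOp_zero_ker` (slots `hδ5 hG5 hH5` displayed) and `stmt349Printed_of_ker_zero` + `fineKernelOfOp_zero_ker`;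
* ★ row 26 (`s3132`) ⇐ n06-i g5 `B9Eq3132SectDLetters.s3132_withSectD` at `𝔏 := lettersYResOfRecord N θ M⋆ 𝔯` (`lettersYOfRecordDE_eq_withSectD`, rfl): the `(QGQ*)⁻¹` half from
  `hco26 : CoerciveUnder …` + `hdec26 : DecayUnder …` of the normalised real matrix `normMatY b26 w ((QGQ*)(U))` of the GENUINE `Q(U)G(U)Q*(U)` (any real basis `b26` of
  M_N(ℂ)), the `(QG₁Q*)⁻¹` half displayed as `h₁26 : Half3132 …`;
* rows 13 (`hB`), 18–19 (`t37 c38 t310 hsum`) DISPLAYED WHOLE as in the predecessor (repaired faces in flight: n06-c g4 `SectBFrame₂`; n06-k g5 `rows131819_definite_geo9Y_rel`).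
WHAT IS DISPLAYED: `hGpE4 hGpH2` · `hB` · the `𝔬39` group + pins · the `𝔬311` group + `hPD` · `t37 c38 t310 hsum` · the `𝔬12` group (letters, numerics, `hcoR12 hco1R12 hcoHR12
hcoG12 hcoR13 hco1R13 hcoG13`, schemas, residuals, pins) · `t314 t314loc` · `b26 hco26 hdec26 h₁26` · `hδ5 hG5 hH5`.  NON-VACUITY STATUS (honest): no displayed binder is
the target of a located negative in the tree; the `Rel`-species co-readings are inhabited at the record's readings by domination (n06-l `coRealizesRel_zero_kernelFamilyB`,
`exists_coRealizesRel_zero_GA_one`) — their discharge at general U is the coordinate device of this seat's OFFER-1 (pub-ymgap INBOX l.16111), not yet typed; `CoRealizesHRel` reads the class, `CoReadsGlob` has no fibre field; the whole obligations, leaves, schemas and residuals are [B9]'s content about genuine letters ∕ free walk data, believed true, NOT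
proved.  HONEST FRAMING.  Kernel bookkeeping; COUNT-NEUTRAL; NOT a discharge claim; the residual letter Δ⁽²⁾ and the Sect.-E letters `P349 Ck` are LOCATED (def-Y
OPS-LETTERS-CONSTRUCTION §8); N06 NOT discharged.  One finite 𝕋⁴ programme at fixed `ε` — NOT ℝ⁴ ∕ OS ∕ mass gap ∕ Clay.  0 `def`, 0 `sorry`.
-/

noncomputable section

namespace Summit.QuantumFields.YangMills.BalabanUVNodes.N06AtOpsYOfRecordDESound

open Literature.MathematicalPhysics.QuantumFieldTheory.Balaban1983to89
open Literature.MathematicalPhysics.QuantumFieldTheory.Balaban1983to89.T4Continuum (T4Family)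
open Literature.MathematicalPhysics.QuantumFieldTheory.Balaban1983to89.DagBinding (WorldP leavesP)
open Literature.MathematicalPhysics.QuantumFieldTheory.Balaban1983to89.Node00
open Literature.MathematicalPhysics.QuantumFieldTheory.Balaban1983to89.B9PinMembersKLevelV1 (MemberY geo9Y bg9Y)
open Literature.MathematicalPhysics.QuantumFieldTheory.Balaban1983to89.B9PinGeometryKLevelV1 (dOmegaY OmKY inΛY unitDistY InCubeY c35Y c35Y_pos)
open Literature.MathematicalPhysics.QuantumFieldTheory.Balaban1983to89.B7Prop2SpecialUnitary (specialUnitaryUnits)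
open Literature.MathematicalPhysics.QuantumFieldTheory.Balaban1983to89.B9Ineq347GAAtLetters (hGA_opsYOfLetters)
open Literature.MathematicalPhysics.QuantumFieldTheory.Balaban1983to89.B9Ineq346SecondOrderGpAtLetters (hGp_opsYOfLetters_of_leaves2)
open Literature.MathematicalPhysics.QuantumFieldTheory.Balaban1983to89.B9ResidualEntriesAtOne (AtOneE4On AtOneH2On)
open Literature.MathematicalPhysics.QuantumFieldTheory.Balaban1983to89.B9Cor35ComparisonsGAAtLetters
  (hGA_e_opsYOfLetters hGA_h1_opsYOfLetters hGA_e4_opsYOfLetters hGA_h2_opsYOfLetters hGA_l2_opsYOfLetters)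
open Literature.MathematicalPhysics.QuantumFieldTheory.Balaban1983to89.B9Cor35ComparisonsGpCAtLetters (hGp_e_opsYOfLetters hGp_h1_opsYOfLetters hC_opsYOfLetters)
open Literature.MathematicalPhysics.QuantumFieldTheory.Balaban1983to89.B9Cor35ComparisonsEH (hE4_of_hGA_e4 hH2_of_hGA_h2)
open Literature.MathematicalPhysics.QuantumFieldTheory.Balaban1983to89.B9Thm314Thm315RecordVacuity (thm315FullPrinted_of_ker_zero)
open Literature.MathematicalPhysics.QuantumFieldTheory.Balaban1983to89.B9RecordDELettersVacuity (siteKernelOfOp_zero_ker fineKernelOfOp_zero_ker stmt349Printed_of_ker_zero)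
open Literature.MathematicalPhysics.QuantumFieldTheory.Balaban1983to89.B9GeoLemma21KLevelV1 (geo9Y_len_pos)
open Literature.MathematicalPhysics.QuantumFieldTheory.Balaban1983to89.B9Thm311Whole (Ops311 PosDefOfOps Inputs311)
open Literature.MathematicalPhysics.QuantumFieldTheory.Balaban1983to89.B9Thm39Whole (WalkReading39)
open Literature.MathematicalPhysics.QuantumFieldTheory.Balaban1983to89.B9Thm39WholeBlk (Ops39Blk StaticOK39Blk Locality39Blk Local348Blk Identities395Blk Small285Blk Factors389Blk)
open Literature.MathematicalPhysics.QuantumFieldTheory.Balaban1983to89.B9Thm39WholeBlkViaDatum (EK39OfOpsBlkVia)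
open Literature.MathematicalPhysics.QuantumFieldTheory.Balaban1983to89.B9Thm39ReadingCoords (repSite39)
open Literature.MathematicalPhysics.QuantumFieldTheory.Balaban1983to89.B9Thm39ReadingAtLetters (X39 blk39 L39 t39_hksum_of_pins_opsYOfLetters)
open Literature.MathematicalPhysics.QuantumFieldTheory.Balaban1983to89.B9RowSum261DefiniteFaces (rowConst261)
open Summit.QuantumFields.YangMills.BalabanUVNodes.N06AtRecord11ObligationsPins (t311_of_pin)
open Summit.QuantumFields.YangMills.BalabanUVNodes.N06AtRecord11ObligationsHg (hg_obligation_vacuous)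
open Summit.QuantumFields.YangMills.BalabanUVNodes.N06AtRecord11CB10YZW (b9_main_of_up_view₁₁B10YZW_of_obligations)
open Literature.MathematicalPhysics.QuantumFieldTheory.Balaban1983to89.B9Thm312Whole (GeoOK Thm33G0 FormSmall HasRWExpOfOps HasRWExpHOfOps PosDefKOfOps)
open Literature.MathematicalPhysics.QuantumFieldTheory.Balaban1983to89.B11SectG (RowSum BlockNorm)
open Literature.MathematicalPhysics.QuantumFieldTheory.Balaban1983to89.B9FromB6 (L2Block)
open Literature.MathematicalPhysics.QuantumFieldTheory.Balaban1983to89.B9Thm312WholeH (LettersH)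
open Literature.MathematicalPhysics.QuantumFieldTheory.Balaban1983to89.B9Thm312WholeLeft (LeftStep)
open Literature.MathematicalPhysics.QuantumFieldTheory.Balaban1983to89.B9Thm313WholeLeft (Letters313D)
open Literature.MathematicalPhysics.QuantumFieldTheory.Balaban1983to89.B9Thm313Whole (Letters313)
open Literature.MathematicalPhysics.QuantumFieldTheory.Balaban1983to89.B9Ineq347CoReading (CoReadsGlob)
open Literature.MathematicalPhysics.QuantumFieldTheory.Balaban1983to89.B9Thm312WholeFacesY (lemma21AboveG_geo9Y)
open Literature.MathematicalPhysics.QuantumFieldTheory.Balaban1983to89.B9GeoNormsKLevelV1 (geo9K_dist_nonneg)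
open Literature.MathematicalPhysics.QuantumFieldTheory.Balaban1983to89.B9GeoLemma21KLevelV1 (distOK_geo9Y rowSum261_geo9Y geo9Y_dist_triangle geo9Y_dist_comm)
open Literature.MathematicalPhysics.QuantumFieldTheory.Balaban1983to89.B9GeoNormsKLevelModelSignsV1 (modelSignsOn_geo9K)
open Literature.MathematicalPhysics.QuantumFieldTheory.Balaban1983to89.B9Thm34Ext (toB6)
open Literature.MathematicalPhysics.QuantumFieldTheory.Balaban1983to89.B9CoRealizesRel (CoRealizesRel)
open Literature.MathematicalPhysics.QuantumFieldTheory.Balaban1983to89.B9CoRealizesRelAtLetters (RelB maj342_relB_left maj342_relB_right dist_eq_of_relB len_eq_of_relB relB_refl)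
open Literature.MathematicalPhysics.QuantumFieldTheory.Balaban1983to89.B9CoRealizesHRel (CoRealizesHRel)
open Literature.MathematicalPhysics.QuantumFieldTheory.Balaban1983to89.B9SectCDiffDict (maj342)
open Literature.MathematicalPhysics.QuantumFieldTheory.Balaban1983to89.B6Ineq2142KLevelV1 (β)
open Literature.MathematicalPhysics.QuantumFieldTheory.Balaban1983to89.B9CarrierBlockMultiplicity (card_sameCarrier_le_kIdx)
open Literature.MathematicalPhysics.QuantumFieldTheory.Balaban1983to89.B9Thm312WholeLeafRelH (thm312Printed_of_stepRelH)
open Literature.MathematicalPhysics.QuantumFieldTheory.Balaban1983to89.B9Thm313WholeLeafRel (thm313Printed_of_stepRel)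
open Literature.MathematicalPhysics.QuantumFieldTheory.Balaban1983to89.B9Eq3132SectDLetters (s3132_withSectD Half3132 QGQY)
open Literature.MathematicalPhysics.QuantumFieldTheory.Balaban1983to89.B9Eq3132CTInputs (CoerciveUnder DecayUnder)
open Literature.MathematicalPhysics.QuantumFieldTheory.Balaban1983to89.B9Eq3132ScalarIndex (geoComap)
open Literature.MathematicalPhysics.QuantumFieldTheory.Balaban1983to89.B9Eq3132RingInverseReading (normMatY)
open scoped Matrix.Norms.L2Operator

variable {N : ℕ}

section Pointed

variable [NeZero N] {F : T4Family}

/-- **THE SOUND CORE OF THE STAGE-11 CERTIFICATE AT def-Y's v3 INSTANCE `opsYOfRecordDE N θ M⋆ 𝔯 𝔈`** (module docstring): `Dag.B9_main` at every run of a world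
bound over the four-pin Stage-11 view, every residual family `𝔯`, every `𝔈`, from: the input-Hölder leaves (3.44)∕(3.45) of G′(1) (row 11); `hB` WHOLE (13); Theorem 3.9's
block-carrier letters + schemas + pins (15–16); Theorem 3.11's letters + `hPD` (17, padded); `t37 c38 t310 hsum` WHOLE (18–19); Theorems 3.12–3.13 on n06-l's REPAIRED
leaves reading the GENUINE Sect.-D letters — walk letters `𝔬12`, numerics, `Rel`-species (3.42)∕(3.133) and glob co-readings, model schemas, residuals, pins; `hsat`∕`hmult`∕`hRdist`∕`hRlen`∕`hL21`∕`hrow`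
DISCHARGED (20–21); Thm 3.14 WHOLE for the genuine `Kdiff` (22–23); the Thm-3.15 slots (24); (3.132) from coercivity + decay of the genuine `QGQ*` matrix + the displayed
`G₁` half (26); rows 1–10, 12, 14, 25 by name.  NOT a discharge of N06. [cite: Balaban1985BackgroundPropagators, Thms 3.1–3.15 pp.397–432, Thm 3.12 (3.122)–(3.133)
pp.420–423, Thm 3.13 (3.153) p.426, Thm 3.14 p.427, (3.42) p.397; Balaban1984PropagatorsII, (2.45) p.231, (2.51)–(2.52) p.232, Lemma 2.1 (2.60)–(2.61) pp.233–234] -/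
theorem b9_main_of_up_view₁₁B10YZW_opsYOfRecordDE_sound
    (θ : Stage11Params F N) (hθ : θ.Admissible) (Mstar : ℕ) (𝔯 : ResY N θ.toStage3Params Mstar) (𝔈 : ExpsY N θ.toStage3Params Mstar) (ζ : ResidZ F N) (lamW : ResidW F N) (w : WorldP)
    (hup : ∀ P, w.up P = upOfRecord₅C F N (θ.view₁₁B10YZW F N Mstar (opsYOfRecordDE N θ.toStage3Params Mstar 𝔯 𝔈) ζ lamW) P)
    [∀ x : MemberY θ.d₆ θ.ℓ₆ θ.hd' θ.hL' θ.b₀ θ.b₁ Mstar, Fintype (geo9Y x).Site] [∀ x : MemberY θ.d₆ θ.ℓ₆ θ.hd' θ.hL' θ.b₀ θ.b₁ Mstar, DecidableEq (geo9Y x).Site]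
    -- row 11: the two input-Hölder leaves (3.44), (3.45) of G′(1) on site arguments (n06-h g3)
    (hGpE4 : AtOneE4On geo9Y (bg9Y (Matrix (Fin N) (Fin N) ℂ) (specialUnitaryUnits (Fin N))) (fun x => ((opsYOfRecordDE N θ.toStage3Params Mstar 𝔯 𝔈) x).Gp) (fun _ lam => ¬ (lam.isRight = true)))
    (hGpH2 : AtOneH2On geo9Y (bg9Y (Matrix (Fin N) (Fin N) ℂ) (specialUnitaryUnits (Fin N))) (fun x => ((opsYOfRecordDE N θ.toStage3Params Mstar 𝔯 𝔈) x).Gp) (fun _ lam => ¬ (lam.isRight = true)))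
    -- row 13 WHOLE: [B9] Sect. B (3.50)–(3.69) step at the instance (repaired face `SectBFrame₂` in flight, n06-c g4)
    (hB : B9.SectBStepPrinted (θ.d₆ + 1) c35Y geo9Y (bg9Y (Matrix (Fin N) (Fin N) ℂ) (specialUnitaryUnits (Fin N))) (fun x => ((opsYOfRecordDE N θ.toStage3Params Mstar 𝔯 𝔈) x).Gp)
      (fun x => ((opsYOfRecordDE N θ.toStage3Params Mstar 𝔯 𝔈) x).GA) (fun x => ((opsYOfRecordDE N θ.toStage3Params Mstar 𝔯 𝔈) x).Cinv) (fun x => ((opsYOfRecordDE N θ.toStage3Params Mstar 𝔯 𝔈) x).IsAnalyticExt))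
    -- rows 15–16: Theorem 3.9's carrier letters on the block carrier `X39`, read by `rd39`; printed-shape schemas; the three pins (n06-j g5)
    {ι39 κ39 : MemberY θ.d₆ θ.ℓ₆ θ.hd' θ.hL' θ.b₀ θ.b₁ Mstar → Type} [∀ x, Fintype (ι39 x)]
    (𝔬39 : ∀ x : MemberY θ.d₆ θ.ℓ₆ θ.hd' θ.hL' θ.b₀ θ.b₁ Mstar,
      Ops39Blk (geo9Y x) (bg9Y (Matrix (Fin N) (Fin N) ℂ) (specialUnitaryUnits (Fin N)) x) (X39 (Matrix (Fin N) (Fin N) ℂ) x.toKIdx) (ι39 x) (κ39 x))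
    (rd39 : ∀ x : MemberY θ.d₆ θ.ℓ₆ θ.hd' θ.hL' θ.b₀ θ.b₁ Mstar, WalkReading39 (bg9Y (Matrix (Fin N) (Fin N) ℂ) (specialUnitaryUnits (Fin N)) x) (ι39 x) (κ39 x))
    (α39 α' r39 δ39 θ39 B39 N39 a39 M39 : ℝ) (h39α : 0 < α39) (h39α1 : α39 < 1) (hα'0 : 0 < α') (hα'1 : α' < 1) (hr39 : 0 < r39) (hrδ39 : r39 ≤ δ39) (hθ39 : 0 ≤ θ39)
    (hB39 : 0 < B39) (hN39 : 0 ≤ N39) (ha39 : 0 < a39) (hM39 : 0 < M39)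
    (hst39 : ∀ x, StaticOK39Blk (𝔬39 x) N39) (hloc39 : ∀ x, Locality39Blk (𝔬39 x) (rd39 x))
    (h39 : ∀ x : MemberY θ.d₆ θ.ℓ₆ θ.hd' θ.hL' θ.b₀ θ.b₁ Mstar, M39 ≤ (geo9Y x).M → ∀ α₀ : ℝ, 0 < α₀ → c35Y * (geo9Y x).M * α₀ ≤ a39 →
      ∀ U : (bg9Y (Matrix (Fin N) (Fin N) ℂ) (specialUnitaryUnits (Fin N)) x).Cfg, (bg9Y (Matrix (Fin N) (Fin N) ℂ) (specialUnitaryUnits (Fin N)) x).Reg335 c35Y α₀ U →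
        Local348Blk (𝔬39 x) B39 δ39 U ∧ Identities395Blk (𝔬39 x) U ∧ Small285Blk (𝔬39 x) θ39 r39 U ∧ Factors389Blk (𝔬39 x) θ39 δ39 U)
    (hblk39 : ∀ x, (𝔬39 x).blk = blk39 (Matrix (Fin N) (Fin N) ℂ) x.toKIdx)
    (hL39 : ∀ x, (𝔬39 x).L = L39 x.toKIdx (lettersYOfRecordDE N θ.toStage3Params Mstar 𝔯 x).parS (lettersYOfRecordDE N θ.toStage3Params Mstar 𝔯 x).Gp)
    (hEK39 : ∀ x : MemberY θ.d₆ θ.ℓ₆ θ.hd' θ.hL' θ.b₀ θ.b₁ Mstar, ((opsYOfRecordDE N θ.toStage3Params Mstar 𝔯 𝔈) x).EK39 =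
      EK39OfOpsBlkVia (𝔬39 x) (rd39 x) (θ.d₆ + 1)
        (2 * (N39 * B39) * rowConst261 (geo9Y (d := θ.d₆) (ℓ := θ.ℓ₆) (hd := θ.hd') (hL := θ.hL') (b₀ := θ.b₀) (b₁ := θ.b₁) (Mstar := Mstar)) (α' * r39))
        ((1 - α') * r39) (repSite39 x.toKIdx))
    -- row 17: Theorem 3.11's letters with `Inputs311` and the pin of the free predicate letter `PosDef` (sound but PADDED at this instance)
    {E7 F7 W7 : MemberY θ.d₆ θ.ℓ₆ θ.hd' θ.hL' θ.b₀ θ.b₁ Mstar → Type} [∀ x, NormedAddCommGroup (E7 x)] [∀ x, InnerProductSpace ℝ (E7 x)] [∀ x, NormedAddCommGroup (F7 x)]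
    [∀ x, InnerProductSpace ℝ (F7 x)] [∀ x, NormedAddCommGroup (W7 x)] [∀ x, InnerProductSpace ℝ (W7 x)] [∀ x, FiniteDimensional ℝ (W7 x)]
    (𝔬311 : ∀ x : MemberY θ.d₆ θ.ℓ₆ θ.hd' θ.hL' θ.b₀ θ.b₁ Mstar, Ops311 (bg9Y (Matrix (Fin N) (Fin N) ℂ) (specialUnitaryUnits (Fin N)) x) (E7 x) (F7 x) (W7 x))
    (θ311 a311 M311 : ℝ) (ha311 : 0 < a311) (hM311 : 0 < M311)
    (h311 : ∀ x : MemberY θ.d₆ θ.ℓ₆ θ.hd' θ.hL' θ.b₀ θ.b₁ Mstar, M311 ≤ (geo9Y x).M → ∀ α₀ : ℝ, 0 < α₀ → (geo9Y x).M * α₀ ≤ a311 →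
      ∀ U : (bg9Y (Matrix (Fin N) (Fin N) ℂ) (specialUnitaryUnits (Fin N)) x).Cfg, (bg9Y (Matrix (Fin N) (Fin N) ℂ) (specialUnitaryUnits (Fin N)) x).Reg335 c35Y α₀ U → Inputs311 (𝔬311 x) θ311 (geo9Y x).M U)
    (hPD : ∀ x : MemberY θ.d₆ θ.ℓ₆ θ.hd' θ.hL' θ.b₀ θ.b₁ Mstar, ((opsYOfRecordDE N θ.toStage3Params Mstar 𝔯 𝔈) x).PosDef = PosDefOfOps (𝔬311 x))
    -- rows 18–19 WHOLE: Thm 3.7, Cor. 3.8, Thm 3.10 and «the random-walk sums yield (3.42)–(3.47)» at the instance (repaired faces: `CoRealizesRel`, n06-l∕n06-k)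
    (t37 : B9.Thm37Printed c35Y geo9Y (bg9Y (Matrix (Fin N) (Fin N) ℂ) (specialUnitaryUnits (Fin N))) (fun x => ((opsYOfRecordDE N θ.toStage3Params Mstar 𝔯 𝔈) x).E37))
    (c38 : B9.Cor38Printed c35Y geo9Y (bg9Y (Matrix (Fin N) (Fin N) ℂ) (specialUnitaryUnits (Fin N))) (fun x => ((opsYOfRecordDE N θ.toStage3Params Mstar 𝔯 𝔈) x).E37))
    (t310 : B9.Thm310Printed c35Y geo9Y (bg9Y (Matrix (Fin N) (Fin N) ℂ) (specialUnitaryUnits (Fin N))) (fun x => ((opsYOfRecordDE N θ.toStage3Params Mstar 𝔯 𝔈) x).E310))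
    (hsum : B9.RWSumsYieldIneqs geo9Y (bg9Y (Matrix (Fin N) (Fin N) ℂ) (specialUnitaryUnits (Fin N))) (fun x => ((opsYOfRecordDE N θ.toStage3Params Mstar 𝔯 𝔈) x).E37)
      (fun x => ((opsYOfRecordDE N θ.toStage3Params Mstar 𝔯 𝔈) x).E310) (fun x => ((opsYOfRecordDE N θ.toStage3Params Mstar 𝔯 𝔈) x).Gp) (fun x => ((opsYOfRecordDE N θ.toStage3Params Mstar 𝔯 𝔈) x).GA))
    -- rows 20–21 on n06-l g3's REPAIRED leaves `thm312Printed_of_stepRelH` ∕ `thm313Printed_of_stepRel`: walk letters `𝔬12`, numerics, (3.42) co-readings in the `Rel` species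
    -- (`RelB` = same carrier block, multiplicity 2(d+1) discharged), (3.133) co-reading `hcoHR12` in the `Rel` species too, (3.47) `hcoG12`∕`hcoG13` fibre-free, model schemas, residuals, pins — reading the GENUINE Sect.-D letters
    {X12 Y12 Z12 W12 : MemberY θ.d₆ θ.ℓ₆ θ.hd' θ.hL' θ.b₀ θ.b₁ Mstar → Type} [∀ x, Fintype (X12 x)] [∀ x, DecidableEq (X12 x)] [∀ x, Fintype (Y12 x)] [∀ x, Fintype (Z12 x)] [∀ x, Fintype (W12 x)]
    (𝔬12 : ∀ x : MemberY θ.d₆ θ.ℓ₆ θ.hd' θ.hL' θ.b₀ θ.b₁ Mstar, B9Thm312Whole.Ops (geo9Y x) (bg9Y (Matrix (Fin N) (Fin N) ℂ) (specialUnitaryUnits (Fin N)) x) (X12 x) (Y12 x) (Z12 x) (W12 x)) (H12 : MemberY θ.d₆ θ.ℓ₆ θ.hd' θ.hL' θ.b₀ θ.b₁ Mstar → Prop)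
    (ev12 : ∀ x : MemberY θ.d₆ θ.ℓ₆ θ.hd' θ.hL' θ.b₀ θ.b₁ Mstar, (geo9Y x).Loc → X12 x → ℝ) (evY12 : ∀ x : MemberY θ.d₆ θ.ℓ₆ θ.hd' θ.hL' θ.b₀ θ.b₁ Mstar, (geo9Y x).Loc → Y12 x → ℝ) (bH13 : ∀ x : MemberY θ.d₆ θ.ℓ₆ θ.hd' θ.hL' θ.b₀ θ.b₁ Mstar, BlockNorm (toB6 (geo9Y x) 1 (H12 x)) (W12 x → ℝ))
    (θ12 θD12 r12 B12₀ δ12₀ δK12 σ12 ρ12 a12 M12 B12₁ δ12₁ B12₃ δ12₃ ρ13 α12 κ13 : ℝ) (Bβ12 Bε12 : ℝ → ℝ) (Bεβ12 : ℝ → ℝ → ℝ) (hθ12 : 0 ≤ θ12) (hθD12 : 0 ≤ θD12) (hr12 : 0 ≤ r12) (hB12₀ : 0 ≤ B12₀) (hB12₃ : 0 ≤ B12₃) (hσ12 : 0 < σ12) (hρ12 : 0 < ρ12) (hρS12 : ρ12 ≤ δ12₀) (hρδ12 : ρ12 + σ12 ≤ δK12)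
    (hρ₃12 : ρ12 + σ12 ≤ δ12₃) (ha12 : 0 < a12) (hM12 : 0 < M12) (hδ12₁ : 0 < δ12₁) (hα12 : 0 < α12) (hα12' : α12 ≤ 1 / 2) (hBβ12 : ∀ β, 0 ≤ Bβ12 β) (hBε12 : ∀ ε, 0 ≤ Bε12 ε) (hBεβ12 : ∀ ε β, 0 ≤ Bεβ12 ε β) (hκ13 : ∀ x, (bH13 x).κ ≤ κ13) (hρ13 : 0 < ρ13) (hρ13ρ : ρ13 + 3 * σ12 ≤ ρ12)
    (hcoR12 : ∀ (x : MemberY θ.d₆ θ.ℓ₆ θ.hd' θ.hL' θ.b₀ θ.b₁ Mstar) (U : (bg9Y (Matrix (Fin N) (Fin N) ℂ) (specialUnitaryUnits (Fin N)) x).Cfg),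
      CoRealizesRel ((opsYOfRecordDE N θ.toStage3Params Mstar 𝔯 𝔈) x).GD 0 U (RelB x.toKIdx) (𝔬12 x).blk (𝔬12 x).blk (ev12 x) ((𝔬12 x).G U) ∧ CoRealizesRel ((opsYOfRecordDE N θ.toStage3Params Mstar 𝔯 𝔈) x).GD 2 U (RelB x.toKIdx) (𝔬12 x).blk (𝔬12 x).blkY (evY12 x) ((𝔬12 x).G U ∘ₗ (𝔬12 x).Dstar U) ∧
      CoRealizesRel ((opsYOfRecordDE N θ.toStage3Params Mstar 𝔯 𝔈) x).G₁ 0 U (RelB x.toKIdx) (𝔬12 x).blk (𝔬12 x).blk (ev12 x) ((𝔬12 x).G1 U) ∧ CoRealizesRel ((opsYOfRecordDE N θ.toStage3Params Mstar 𝔯 𝔈) x).G₁ 2 U (RelB x.toKIdx) (𝔬12 x).blk (𝔬12 x).blkY (evY12 x) ((𝔬12 x).G1 U ∘ₗ (𝔬12 x).Dstar U))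
    (hco1R12 : ∀ (x : MemberY θ.d₆ θ.ℓ₆ θ.hd' θ.hL' θ.b₀ θ.b₁ Mstar) (U : (bg9Y (Matrix (Fin N) (Fin N) ℂ) (specialUnitaryUnits (Fin N)) x).Cfg),
      CoRealizesRel ((opsYOfRecordDE N θ.toStage3Params Mstar 𝔯 𝔈) x).GD 1 U (RelB x.toKIdx) (𝔬12 x).blkY (𝔬12 x).blk (ev12 x) ((𝔬12 x).D U ∘ₗ (𝔬12 x).G U) ∧ CoRealizesRel ((opsYOfRecordDE N θ.toStage3Params Mstar 𝔯 𝔈) x).G₁ 1 U (RelB x.toKIdx) (𝔬12 x).blkY (𝔬12 x).blk (ev12 x) ((𝔬12 x).D U ∘ₗ (𝔬12 x).G1 U))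
    (hcoHR12 : ∀ (x : MemberY θ.d₆ θ.ℓ₆ θ.hd' θ.hL' θ.b₀ θ.b₁ Mstar) (U : (bg9Y (Matrix (Fin N) (Fin N) ℂ) (specialUnitaryUnits (Fin N)) x).Cfg),
      CoRealizesHRel ((opsYOfRecordDE N θ.toStage3Params Mstar 𝔯 𝔈) x).H 0 U (θ.d₆ + 1) (RelB x.toKIdx) (𝔬12 x).blk (𝔬12 x).blkZ ((𝔬12 x).Hm U) ∧ CoRealizesHRel ((opsYOfRecordDE N θ.toStage3Params Mstar 𝔯 𝔈) x).H 1 U (θ.d₆ + 1) (RelB x.toKIdx) (𝔬12 x).blkY (𝔬12 x).blkZ ((𝔬12 x).D U ∘ₗ (𝔬12 x).Hm U) ∧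
      CoRealizesHRel ((opsYOfRecordDE N θ.toStage3Params Mstar 𝔯 𝔈) x).H₁ 0 U (θ.d₆ + 1) (RelB x.toKIdx) (𝔬12 x).blk (𝔬12 x).blkZ ((𝔬12 x).H1m U) ∧ CoRealizesHRel ((opsYOfRecordDE N θ.toStage3Params Mstar 𝔯 𝔈) x).H₁ 1 U (θ.d₆ + 1) (RelB x.toKIdx) (𝔬12 x).blkY (𝔬12 x).blkZ ((𝔬12 x).D U ∘ₗ (𝔬12 x).H1m U))
    (hcoG12 : ∀ (x : MemberY θ.d₆ θ.ℓ₆ θ.hd' θ.hL' θ.b₀ θ.b₁ Mstar) (U : (bg9Y (Matrix (Fin N) (Fin N) ℂ) (specialUnitaryUnits (Fin N)) x).Cfg),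
      CoReadsGlob ((opsYOfRecordDE N θ.toStage3Params Mstar 𝔯 𝔈) x).GD 0 U (𝔬12 x).blk (𝔬12 x).blk (ev12 x) ((𝔬12 x).G U) ∧ CoReadsGlob ((opsYOfRecordDE N θ.toStage3Params Mstar 𝔯 𝔈) x).GD 1 U (𝔬12 x).blkY (𝔬12 x).blk (ev12 x) ((𝔬12 x).D U ∘ₗ (𝔬12 x).G U) ∧
      CoReadsGlob ((opsYOfRecordDE N θ.toStage3Params Mstar 𝔯 𝔈) x).GD 2 U (𝔬12 x).blk (𝔬12 x).blkY (evY12 x) ((𝔬12 x).G U ∘ₗ (𝔬12 x).Dstar U) ∧ CoReadsGlob ((opsYOfRecordDE N θ.toStage3Params Mstar 𝔯 𝔈) x).G₁ 0 U (𝔬12 x).blk (𝔬12 x).blk (ev12 x) ((𝔬12 x).G1 U) ∧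
      CoReadsGlob ((opsYOfRecordDE N θ.toStage3Params Mstar 𝔯 𝔈) x).G₁ 1 U (𝔬12 x).blkY (𝔬12 x).blk (ev12 x) ((𝔬12 x).D U ∘ₗ (𝔬12 x).G1 U) ∧ CoReadsGlob ((opsYOfRecordDE N θ.toStage3Params Mstar 𝔯 𝔈) x).G₁ 2 U (𝔬12 x).blk (𝔬12 x).blkY (evY12 x) ((𝔬12 x).G1 U ∘ₗ (𝔬12 x).Dstar U))
    (hmodel12 : ∀ x : MemberY θ.d₆ θ.ℓ₆ θ.hd' θ.hL' θ.b₀ θ.b₁ Mstar, M12 ≤ (geo9Y x).M → ∀ α₀ : ℝ, 0 < α₀ → (geo9Y x).M * α₀ ≤ a12 →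
      ∀ U : (bg9Y (Matrix (Fin N) (Fin N) ℂ) (specialUnitaryUnits (Fin N)) x).Cfg, (bg9Y (Matrix (Fin N) (Fin N) ℂ) (specialUnitaryUnits (Fin N)) x).Reg335 c35Y α₀ U → (bg9Y (Matrix (Fin N) (Fin N) ℂ) (specialUnitaryUnits (Fin N)) x).Reg336 c35Y α₀ U →
        Thm33G0 (𝔬12 x) 1 (H12 x) B12₀ δ12₀ U ∧ B9Thm312Whole.Step (𝔬12 x) 1 (H12 x) (fun y => (geo9Y_len_pos x y).le) 1 (θ12 * ((geo9Y x).M * α₀)) δK12 U ∧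
        B9Thm312Whole.Step (𝔬12 x) 1 (H12 x) (fun y => (geo9Y_len_pos x y).le) 2 (θ12 * ((geo9Y x).M * α₀)) δK12 U ∧ FormSmall (𝔬12 x) (r12 * ((geo9Y x).M * α₀)) U ∧ B9Thm312Whole.Identities (𝔬12 x) U)
    (hleft12 : ∀ x : MemberY θ.d₆ θ.ℓ₆ θ.hd' θ.hL' θ.b₀ θ.b₁ Mstar, M12 ≤ (geo9Y x).M → ∀ α₀ : ℝ, 0 < α₀ → (geo9Y x).M * α₀ ≤ a12 →
      ∀ U : (bg9Y (Matrix (Fin N) (Fin N) ℂ) (specialUnitaryUnits (Fin N)) x).Cfg, (bg9Y (Matrix (Fin N) (Fin N) ℂ) (specialUnitaryUnits (Fin N)) x).Reg335 c35Y α₀ U → (bg9Y (Matrix (Fin N) (Fin N) ℂ) (specialUnitaryUnits (Fin N)) x).Reg336 c35Y α₀ U →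
        LeftStep (𝔬12 x) 1 (H12 x) (fun y => (geo9Y_len_pos x y).le) B12₀ δ12₀ (θD12 * ((geo9Y x).M * α₀)) δK12 U) (hlettersH12 : ∀ x : MemberY θ.d₆ θ.ℓ₆ θ.hd' θ.hL' θ.b₀ θ.b₁ Mstar, M12 ≤ (geo9Y x).M → ∀ α₀ : ℝ, 0 < α₀ → (geo9Y x).M * α₀ ≤ a12 →
      ∀ U : (bg9Y (Matrix (Fin N) (Fin N) ℂ) (specialUnitaryUnits (Fin N)) x).Cfg, (bg9Y (Matrix (Fin N) (Fin N) ℂ) (specialUnitaryUnits (Fin N)) x).Reg335 c35Y α₀ U → (bg9Y (Matrix (Fin N) (Fin N) ℂ) (specialUnitaryUnits (Fin N)) x).Reg336 c35Y α₀ U →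
        LettersH (𝔬12 x) 1 (H12 x) ⟨geo9Y_dist_triangle x, geo9Y_dist_comm x, geo9K_dist_nonneg x.toKIdx, geo9Y_len_pos x⟩ B12₃ δ12₃ U) (hres12 : ∀ x : MemberY θ.d₆ θ.ℓ₆ θ.hd' θ.hL' θ.b₀ θ.b₁ Mstar, M12 ≤ (geo9Y x).M → ∀ α₀ : ℝ, 0 < α₀ → (geo9Y x).M * α₀ ≤ a12 →
      ∀ U : (bg9Y (Matrix (Fin N) (Fin N) ℂ) (specialUnitaryUnits (Fin N)) x).Cfg, (bg9Y (Matrix (Fin N) (Fin N) ℂ) (specialUnitaryUnits (Fin N)) x).Reg335 c35Y α₀ U → (bg9Y (Matrix (Fin N) (Fin N) ℂ) (specialUnitaryUnits (Fin N)) x).Reg336 c35Y α₀ U →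
        (∀ K ∈ [((opsYOfRecordDE N θ.toStage3Params Mstar 𝔯 𝔈) x).GD, ((opsYOfRecordDE N θ.toStage3Params Mstar 𝔯 𝔈) x).G₁], L2Block K B12₁ δ12₁ U ∧ B9.Ineq343_345 K Bβ12 Bε12 Bεβ12 δ12₁ U) ∧
        (∀ Hk' ∈ [((opsYOfRecordDE N θ.toStage3Params Mstar 𝔯 𝔈) x).H, ((opsYOfRecordDE N θ.toStage3Params Mstar 𝔯 𝔈) x).H₁], ∀ (β : ℝ) (ζ : (geo9Y x).Cut) (y y' : (geo9Y x).Site), 0 ≤ β → β < 1 → (geo9Y x).cutInT ζ y →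
          Hk'.h U β ζ y' ≤ Bβ12 β * (geo9Y x).cutH β ζ * ((geo9Y x).len y) ^ (-(1 + β)) * ((geo9Y x).len y') ^ (-((θ.d₆ + 1 : ℕ) : ℝ)) * Real.exp (-(δ12₁ / 2 * (geo9Y x).dist y y'))))
    (hpinE : ∀ x : MemberY θ.d₆ θ.ℓ₆ θ.hd' θ.hL' θ.b₀ θ.b₁ Mstar, ((opsYOfRecordDE N θ.toStage3Params Mstar 𝔯 𝔈) x).HasRWExp = HasRWExpOfOps (𝔬12 x)) (hpinH : ∀ x : MemberY θ.d₆ θ.ℓ₆ θ.hd' θ.hL' θ.b₀ θ.b₁ Mstar, ((opsYOfRecordDE N θ.toStage3Params Mstar 𝔯 𝔈) x).HasRWExpH = HasRWExpHOfOps (𝔬12 x))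
    (hpinK : ∀ x : MemberY θ.d₆ θ.ℓ₆ θ.hd' θ.hL' θ.b₀ θ.b₁ Mstar, ((opsYOfRecordDE N θ.toStage3Params Mstar 𝔯 𝔈) x).PosDefK = PosDefKOfOps (𝔬12 x)) (hcoR13 : ∀ (x : MemberY θ.d₆ θ.ℓ₆ θ.hd' θ.hL' θ.b₀ θ.b₁ Mstar) (U : (bg9Y (Matrix (Fin N) (Fin N) ℂ) (specialUnitaryUnits (Fin N)) x).Cfg),
      CoRealizesRel ((opsYOfRecordDE N θ.toStage3Params Mstar 𝔯 𝔈) x).GG 0 U (RelB x.toKIdx) (𝔬12 x).blk (𝔬12 x).blk (ev12 x) ((𝔬12 x).GG U) ∧ CoRealizesRel ((opsYOfRecordDE N θ.toStage3Params Mstar 𝔯 𝔈) x).GG 2 U (RelB x.toKIdx) (𝔬12 x).blk (𝔬12 x).blkY (evY12 x) ((𝔬12 x).GG U ∘ₗ (𝔬12 x).Dstar U))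
    (hco1R13 : ∀ (x : MemberY θ.d₆ θ.ℓ₆ θ.hd' θ.hL' θ.b₀ θ.b₁ Mstar) (U : (bg9Y (Matrix (Fin N) (Fin N) ℂ) (specialUnitaryUnits (Fin N)) x).Cfg), CoRealizesRel ((opsYOfRecordDE N θ.toStage3Params Mstar 𝔯 𝔈) x).GG 1 U (RelB x.toKIdx) (𝔬12 x).blkY (𝔬12 x).blk (ev12 x) ((𝔬12 x).D U ∘ₗ (𝔬12 x).GG U))
    (hcoG13 : ∀ (x : MemberY θ.d₆ θ.ℓ₆ θ.hd' θ.hL' θ.b₀ θ.b₁ Mstar) (U : (bg9Y (Matrix (Fin N) (Fin N) ℂ) (specialUnitaryUnits (Fin N)) x).Cfg), CoReadsGlob ((opsYOfRecordDE N θ.toStage3Params Mstar 𝔯 𝔈) x).GG 0 U (𝔬12 x).blk (𝔬12 x).blk (ev12 x) ((𝔬12 x).GG U) ∧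
      CoReadsGlob ((opsYOfRecordDE N θ.toStage3Params Mstar 𝔯 𝔈) x).GG 1 U (𝔬12 x).blkY (𝔬12 x).blk (ev12 x) ((𝔬12 x).D U ∘ₗ (𝔬12 x).GG U) ∧ CoReadsGlob ((opsYOfRecordDE N θ.toStage3Params Mstar 𝔯 𝔈) x).GG 2 U (𝔬12 x).blk (𝔬12 x).blkY (evY12 x) ((𝔬12 x).GG U ∘ₗ (𝔬12 x).Dstar U))
    (hletters13 : ∀ x : MemberY θ.d₆ θ.ℓ₆ θ.hd' θ.hL' θ.b₀ θ.b₁ Mstar, M12 ≤ (geo9Y x).M → ∀ α₀ : ℝ, 0 < α₀ → (geo9Y x).M * α₀ ≤ a12 →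
      ∀ U : (bg9Y (Matrix (Fin N) (Fin N) ℂ) (specialUnitaryUnits (Fin N)) x).Cfg, (bg9Y (Matrix (Fin N) (Fin N) ℂ) (specialUnitaryUnits (Fin N)) x).Reg335 c35Y α₀ U → (bg9Y (Matrix (Fin N) (Fin N) ℂ) (specialUnitaryUnits (Fin N)) x).Reg336 c35Y α₀ U →
        Letters313 (𝔬12 x) 1 (H12 x) ⟨geo9Y_dist_triangle x, geo9Y_dist_comm x, geo9K_dist_nonneg x.toKIdx, geo9Y_len_pos x⟩ B12₃ δ12₃ U) (hlettersD13 : ∀ x : MemberY θ.d₆ θ.ℓ₆ θ.hd' θ.hL' θ.b₀ θ.b₁ Mstar, M12 ≤ (geo9Y x).M → ∀ α₀ : ℝ, 0 < α₀ → (geo9Y x).M * α₀ ≤ a12 →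
      ∀ U : (bg9Y (Matrix (Fin N) (Fin N) ℂ) (specialUnitaryUnits (Fin N)) x).Cfg, (bg9Y (Matrix (Fin N) (Fin N) ℂ) (specialUnitaryUnits (Fin N)) x).Reg335 c35Y α₀ U → (bg9Y (Matrix (Fin N) (Fin N) ℂ) (specialUnitaryUnits (Fin N)) x).Reg336 c35Y α₀ U →
        Letters313D (𝔬12 x) 1 (H12 x) ⟨geo9Y_dist_triangle x, geo9Y_dist_comm x, geo9K_dist_nonneg x.toKIdx, geo9Y_len_pos x⟩ B12₃ δ12₃ (bH13 x) U) (hres13 : ∀ x : MemberY θ.d₆ θ.ℓ₆ θ.hd' θ.hL' θ.b₀ θ.b₁ Mstar, M12 ≤ (geo9Y x).M → ∀ α₀ : ℝ, 0 < α₀ → (geo9Y x).M * α₀ ≤ a12 →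
      ∀ U : (bg9Y (Matrix (Fin N) (Fin N) ℂ) (specialUnitaryUnits (Fin N)) x).Cfg, (bg9Y (Matrix (Fin N) (Fin N) ℂ) (specialUnitaryUnits (Fin N)) x).Reg335 c35Y α₀ U → (bg9Y (Matrix (Fin N) (Fin N) ℂ) (specialUnitaryUnits (Fin N)) x).Reg336 c35Y α₀ U →
        L2Block ((opsYOfRecordDE N θ.toStage3Params Mstar 𝔯 𝔈) x).GG B12₁ δ12₁ U ∧ B9.Ineq343_345 ((opsYOfRecordDE N θ.toStage3Params Mstar 𝔯 𝔈) x).GG Bβ12 Bε12 Bεβ12 δ12₁ U)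
    -- rows 22–23 WHOLE: Thm 3.14 global ∕ localised for the GENUINE difference letter `Kdiff = G(Ω,U) − G(Ω′,U)` of the v3 record (n06-m's reading-calculus faces are the sequel)
    (t314 : B9.Thm314Printed c35Y geo9Y (bg9Y (Matrix (Fin N) (Fin N) ℂ) (specialUnitaryUnits (Fin N))) (fun x => ((opsYOfRecordDE N θ.toStage3Params Mstar 𝔯 𝔈) x).Kdiff) dOmegaY)
    (t314loc : B9Thm314.Thm314LocalPrinted c35Y geo9Y (bg9Y (Matrix (Fin N) (Fin N) ℂ) (specialUnitaryUnits (Fin N))) (fun x => ((opsYOfRecordDE N θ.toStage3Params Mstar 𝔯 𝔈) x).Kdiff) OmKY dOmegaY)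
    -- row 26 on n06-i g5's face `s3132_withSectD`: the `(QGQ*)⁻¹` half ⇐ COERCIVITY + DECAY of the normalised real matrix of the GENUINE `Q(U)G(U)Q*(U)` (any real basis
    -- `b26` of M_N(ℂ), n06-i∕n06-g4's ring-inverse reading), the `(QG₁Q*)⁻¹` half displayed (`Half3132`) — reading the GENUINE Sect.-D letters of the v3 record
    {Ff : Type} [Fintype Ff] [DecidableEq Ff] (b26 : Module.Basis Ff ℝ (Matrix (Fin N) (Fin N) ℂ))
    (hco26 : CoerciveUnder c35Y (fun x : MemberY θ.d₆ θ.ℓ₆ θ.hd' θ.hL' θ.b₀ θ.b₁ Mstar => geoComap (geo9Y x) (Prod.fst : (geo9Y x).Site × Ff → (geo9Y x).Site)) (bg9Y (Matrix (Fin N) (Fin N) ℂ) (specialUnitaryUnits (Fin N)))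
      (fun x U => normMatY b26 (fun y => (geo9Y x).len y ^ (-(1 + ((θ.d₆ + 1 : ℕ) : ℝ) / 2)))
        (QGQY x.toKIdx (lettersYOfRecord N θ.toStage3Params Mstar x).parS (lettersYOfRecord N θ.toStage3Params Mstar x).parB (lettersYOfRecord N θ.toStage3Params Mstar x).Gp U)))
    (hdec26 : DecayUnder c35Y (fun x : MemberY θ.d₆ θ.ℓ₆ θ.hd' θ.hL' θ.b₀ θ.b₁ Mstar => geoComap (geo9Y x) (Prod.fst : (geo9Y x).Site × Ff → (geo9Y x).Site)) (bg9Y (Matrix (Fin N) (Fin N) ℂ) (specialUnitaryUnits (Fin N)))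
      (fun x U => normMatY b26 (fun y => (geo9Y x).len y ^ (-(1 + ((θ.d₆ + 1 : ℕ) : ℝ) / 2)))
        (QGQY x.toKIdx (lettersYOfRecord N θ.toStage3Params Mstar x).parS (lettersYOfRecord N θ.toStage3Params Mstar x).parB (lettersYOfRecord N θ.toStage3Params Mstar x).Gp U)))
    (h₁26 : Half3132 (θ.d₆ + 1) c35Y geo9Y (bg9Y (Matrix (Fin N) (Fin N) ℂ) (specialUnitaryUnits (Fin N))) (fun x => ((opsYOfRecordDE N θ.toStage3Params Mstar 𝔯 𝔈) x).QG1Qinv))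
    -- row 24: the two Thm-3.15 expansion-letter slots and the rate (rows 22, 23, 25, 26 hold vacuously at the flat letters, by name below)
    {δ5 : ℝ} (hδ5 : 0 < δ5)
    (hG5 : ∀ (x : MemberY θ.d₆ θ.ℓ₆ θ.hd' θ.hL' θ.b₀ θ.b₁ Mstar) (U : (bg9Y (Matrix (Fin N) (Fin N) ℂ) (specialUnitaryUnits (Fin N)) x).Cfg), ((opsYOfRecordDE N θ.toStage3Params Mstar 𝔯 𝔈) x).GivenBy3185 U)
    (hH5 : ∀ (x : MemberY θ.d₆ θ.ℓ₆ θ.hd' θ.hL' θ.b₀ θ.b₁ Mstar) (U : (bg9Y (Matrix (Fin N) (Fin N) ℂ) (specialUnitaryUnits (Fin N)) x).Cfg), ((opsYOfRecordDE N θ.toStage3Params Mstar 𝔯 𝔈) x).HasRWExpC U δ5)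
    (P : B12.RunParams) : Dag.B9_main (leavesP w P) := by
  have hL1 : (1 : ℝ) ≤ ((θ.ℓ₆ + 1 : ℕ) : ℝ) := by exact_mod_cast Nat.succ_le_succ (Nat.zero_le _)
  have t311 := t311_of_pin θ.toStage3Params Mstar (opsYOfRecordDE N θ.toStage3Params Mstar 𝔯 𝔈) 𝔬311 θ311 a311 M311 ha311 hM311 h311 hPD
  have t315 : B9.Thm315FullPrinted c35Y geo9Y (bg9Y (Matrix (Fin N) (Fin N) ℂ) (specialUnitaryUnits (Fin N))) (fun x => ((opsYOfRecordDE N θ.toStage3Params Mstar 𝔯 𝔈) x).Ck) inΛY unitDistY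
      (fun x => ((opsYOfRecordDE N θ.toStage3Params Mstar 𝔯 𝔈) x).GivenBy3185) (fun x => ((opsYOfRecordDE N θ.toStage3Params Mstar 𝔯 𝔈) x).HasRWExpC) :=
    thm315FullPrinted_of_ker_zero _ _ _ _ _ (fun x U y y' => siteKernelOfOp_zero_ker x.toKIdx (bg9Y (Matrix (Fin N) (Fin N) ℂ) (specialUnitaryUnits (Fin N)) x) (fun U => U) _ _ U y y') hδ5 hG5 hH5
  have hGp := hGp_opsYOfLetters_of_leaves2 N θ.toStage3Params Mstar (lettersYOfRecordDE N θ.toStage3Params Mstar 𝔯) 𝔈 hGpE4 hGpH2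
  have hGA := hGA_opsYOfLetters N θ.toStage3Params Mstar (lettersYOfRecordDE N θ.toStage3Params Mstar 𝔯) 𝔈
  obtain ⟨t39, hksum⟩ := t39_hksum_of_pins_opsYOfLetters θ.toStage3Params Mstar (lettersYOfRecordDE N θ.toStage3Params Mstar 𝔯) 𝔈 𝔬39 rd39 α39 α' r39 δ39
    θ39 B39 N39 a39 M39 h39α h39α1 hα'0 hα'1 hr39 hrδ39 hθ39 hB39 hN39 ha39 hM39 hst39 hloc39 h39 (fun _ => rfl) hblk39 hL39 hEK39
  haveI hdecR : ∀ x : MemberY θ.d₆ θ.ℓ₆ θ.hd' θ.hL' θ.b₀ θ.b₁ Mstar, DecidableRel (RelB x.toKIdx) := fun x c c' =>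
    show Decidable (β x.hN x.D x.hk c = β x.hN x.D x.hk c') from inferInstance
  have hsat : ∀ (x : MemberY θ.d₆ θ.ℓ₆ θ.hd' θ.hL' θ.b₀ θ.b₁ Mstar) (n : Fin 4) (B' δ' : ℝ),
      (∀ a a' b, RelB x.toKIdx a a' → maj342 (geo9Y x) n B' δ' a b = maj342 (geo9Y x) n B' δ' a' b) ∧
      (∀ a b b', RelB x.toKIdx b b' → maj342 (geo9Y x) n B' δ' a b = maj342 (geo9Y x) n B' δ' a b') :=
    fun x n B' δ' => ⟨fun a a' b h => maj342_relB_left x.toKIdx n B' δ' a a' b h, fun a b b' h => maj342_relB_right x.toKIdx n B' δ' a b b' h⟩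
  have hmult : ∀ (x : MemberY θ.d₆ θ.ℓ₆ θ.hd' θ.hL' θ.b₀ θ.b₁ Mstar) (y' : (geo9Y x).Site),
      (Finset.univ.filter (fun y'' : (geo9Y x).Site => RelB x.toKIdx y'' y')).card ≤ 2 * (θ.d₆ + 1) := fun x y' => by
    refine le_trans (Finset.card_le_card fun c hc => ?_) (card_sameCarrier_le_kIdx x.toKIdx y')
    exact Finset.mem_filter.2 ⟨@Finset.mem_univ _ (_) c, (Finset.mem_filter.1 hc).2⟩
  have hRdist : ∀ (x : MemberY θ.d₆ θ.ℓ₆ θ.hd' θ.hL' θ.b₀ θ.b₁ Mstar) (a a' b : (geo9Y x).Site), RelB x.toKIdx a a' → (geo9Y x).dist a b = (geo9Y x).dist a' b :=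
    fun x a a' b h => dist_eq_of_relB x.toKIdx h (relB_refl x.toKIdx b)
  have hRlen : ∀ (x : MemberY θ.d₆ θ.ℓ₆ θ.hd' θ.hL' θ.b₀ θ.b₁ Mstar) (a a' : (geo9Y x).Site), RelB x.toKIdx a a' → (geo9Y x).len a = (geo9Y x).len a' :=
    fun x a a' h => len_eq_of_relB x.toKIdx h
  have hgeoOK : ∀ x : MemberY θ.d₆ θ.ℓ₆ θ.hd' θ.hL' θ.b₀ θ.b₁ Mstar, GeoOK (geo9Y x) := fun x => ⟨geo9Y_dist_triangle x, geo9Y_dist_comm x, geo9K_dist_nonneg x.toKIdx, geo9Y_len_pos x⟩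
  obtain ⟨ML12, c12, hrow12⟩ := rowSum261_geo9Y (d := θ.d₆) (ℓ := θ.ℓ₆) (hd := θ.hd') (hL := θ.hL') (b₀ := θ.b₀) (b₁ := θ.b₁) (Mstar := Mstar) σ12 hσ12
  have hrow : ∀ x : MemberY θ.d₆ θ.ℓ₆ θ.hd' θ.hL' θ.b₀ θ.b₁ Mstar, ML12 ≤ (geo9Y x).M → RowSum (toB6 (geo9Y x) 1 (H12 x)) σ12 (max c12 0) := fun x hM y => (hrow12 x hM y).trans (le_max_left _ _)
  have hE : (fun x => ((opsYOfRecordDE N θ.toStage3Params Mstar 𝔯 𝔈) x).HasRWExp) = fun x => HasRWExpOfOps (𝔬12 x) := funext hpinE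
  have hH : (fun x => ((opsYOfRecordDE N θ.toStage3Params Mstar 𝔯 𝔈) x).HasRWExpH) = fun x => HasRWExpHOfOps (𝔬12 x) := funext hpinH
  have hK' : (fun x => ((opsYOfRecordDE N θ.toStage3Params Mstar 𝔯 𝔈) x).PosDefK) = fun x => PosDefKOfOps (𝔬12 x) := funext hpinK
  have hη : ∀ x : MemberY θ.d₆ θ.ℓ₆ θ.hd' θ.hL' θ.b₀ θ.b₁ Mstar, 0 < (geo9Y x).eta := fun x => (distOK_geo9Y x).eta_pos
  have hL21 := lemma21AboveG_geo9Y (d := θ.d₆) (ℓ := θ.ℓ₆) (hd := θ.hd') (hL := θ.hL') (b₀ := θ.b₀) (b₁ := θ.b₁) (Mstar := Mstar) H12 hα12 (hα12'.trans_lt one_half_lt_one)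
  have t312 : B9.Thm312Printed (θ.d₆ + 1) c35Y geo9Y (bg9Y (Matrix (Fin N) (Fin N) ℂ) (specialUnitaryUnits (Fin N))) (fun x => ((opsYOfRecordDE N θ.toStage3Params Mstar 𝔯 𝔈) x).GD) (fun x => ((opsYOfRecordDE N θ.toStage3Params Mstar 𝔯 𝔈) x).G₁)
      (fun x => ((opsYOfRecordDE N θ.toStage3Params Mstar 𝔯 𝔈) x).H) (fun x => ((opsYOfRecordDE N θ.toStage3Params Mstar 𝔯 𝔈) x).H₁) (fun x => ((opsYOfRecordDE N θ.toStage3Params Mstar 𝔯 𝔈) x).HasRWExp) (fun x => ((opsYOfRecordDE N θ.toStage3Params Mstar 𝔯 𝔈) x).HasRWExpH)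
      (fun x => ((opsYOfRecordDE N θ.toStage3Params Mstar 𝔯 𝔈) x).PosDefK) := by
    rw [hE, hH, hK']
    exact thm312Printed_of_stepRelH 𝔬12 (fun _ => 1) H12 (fun x => ((opsYOfRecordDE N θ.toStage3Params Mstar 𝔯 𝔈) x).GD) (fun x => ((opsYOfRecordDE N θ.toStage3Params Mstar 𝔯 𝔈) x).G₁) (fun x => ((opsYOfRecordDE N θ.toStage3Params Mstar 𝔯 𝔈) x).H)
      (fun x => ((opsYOfRecordDE N θ.toStage3Params Mstar 𝔯 𝔈) x).H₁) ev12 evY12 (fun x => RelB x.toKIdx) (2 * (θ.d₆ + 1)) θ12 θD12 r12 B12₀ δ12₀ δK12 σ12 (max c12 0) ρ12 a12 M12 ML12 B12₁ δ12₁ B12₃ δ12₃ α12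
      ((θ.ℓ₆ + 1 : ℕ) : ℝ) Bβ12 Bε12 Bεβ12 hθ12 hθD12 hr12 hB12₀ hB12₃ hσ12.le hρ12 hρS12 hρδ12 hρ₃12 (le_max_right _ _) ha12 hM12 hδ12₁ hα12' hBβ12 hBε12 hBεβ12 hgeoOK
      (fun x => modelSignsOn_geo9K x.toKIdx) (fun _ => hL1) (fun _ => le_rfl) hη hrow hL21 hsat hmult hRdist hRlen hcoR12 hco1R12 hcoHR12 hcoG12 hmodel12 hleft12 hlettersH12 hres12
  have t313 : B9.Thm313Printed c35Y geo9Y (bg9Y (Matrix (Fin N) (Fin N) ℂ) (specialUnitaryUnits (Fin N))) (fun x => ((opsYOfRecordDE N θ.toStage3Params Mstar 𝔯 𝔈) x).GG) (fun x => ((opsYOfRecordDE N θ.toStage3Params Mstar 𝔯 𝔈) x).HasRWExp) (fun x => ((opsYOfRecordDE N θ.toStage3Params Mstar 𝔯 𝔈) x).PosDefK) := by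
    rw [hE, hK']
    exact thm313Printed_of_stepRel 𝔬12 (fun _ => 1) H12 (fun x => ((opsYOfRecordDE N θ.toStage3Params Mstar 𝔯 𝔈) x).GG) bH13 ev12 evY12 (fun x => RelB x.toKIdx) (2 * (θ.d₆ + 1)) θ12 θD12 r12 B12₀ δ12₀ δK12 σ12 (max c12 0) ρ12 a12 M12 ML12
      B12₁ δ12₁ B12₃ δ12₃ ρ13 α12 ((θ.ℓ₆ + 1 : ℕ) : ℝ) κ13 Bβ12 Bε12 Bεβ12 hθ12 hθD12 hr12 hB12₀ hB12₃ hσ12.le hρ13 hρ13ρ hρS12 (le_trans (by linarith only [hσ12]) hρ₃12) hρδ12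
      (le_max_right _ _) ha12 hM12 hδ12₁ hBβ12 hBε12 hBεβ12 hgeoOK (fun x => modelSignsOn_geo9K x.toKIdx) (fun _ => hL1) (fun _ => le_rfl) hη hκ13 hrow hL21 hsat hmult hcoR13 hco1R13 hcoG13
      hmodel12 hleft12 hletters13 hlettersD13 hres13
  have hE4 := hE4_of_hGA_e4 (opsYOfRecordDE N θ.toStage3Params Mstar 𝔯 𝔈) (hGA_e4_opsYOfLetters N θ.toStage3Params Mstar (lettersYOfRecordDE N θ.toStage3Params Mstar 𝔯) 𝔈)
  have hH2 := hH2_of_hGA_h2 (opsYOfRecordDE N θ.toStage3Params Mstar 𝔯 𝔈) (hGA_h2_opsYOfLetters N θ.toStage3Params Mstar (lettersYOfRecordDE N θ.toStage3Params Mstar 𝔯) 𝔈)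
  have hg := hg_obligation_vacuous θ.toStage3Params Mstar (opsYOfRecordDE N θ.toStage3Params Mstar 𝔯 𝔈)
  have s349 : B9.Stmt349Printed (θ.d₆ + 1) c35Y geo9Y (bg9Y (Matrix (Fin N) (Fin N) ℂ) (specialUnitaryUnits (Fin N))) (fun x => ((opsYOfRecordDE N θ.toStage3Params Mstar 𝔯 𝔈) x).P349) :=
    stmt349Printed_of_ker_zero (θ.d₆ + 1) c35Y _ (fun x n U y y' => fineKernelOfOp_zero_ker x.toKIdx (bg9Y (Matrix (Fin N) (Fin N) ℂ) (specialUnitaryUnits (Fin N)) x) (fun U => U) n U y y')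
      (fun x y => (geo9Y_len_pos x y).le)
  have s3132 := s3132_withSectD θ.toStage3Params Mstar (lettersYResOfRecord N θ.toStage3Params Mstar 𝔯) 𝔈 (θ.d₆ + 1) b26 hco26 hdec26 h₁26
  exact b9_main_of_up_view₁₁B10YZW_of_obligations θ hθ Mstar (opsYOfRecordDE N θ.toStage3Params Mstar 𝔯 𝔈) ζ lamW w hup
    (hGp_e_opsYOfLetters N θ.toStage3Params Mstar (lettersYOfRecordDE N θ.toStage3Params Mstar 𝔯) 𝔈) (hGp_h1_opsYOfLetters N θ.toStage3Params Mstar (lettersYOfRecordDE N θ.toStage3Params Mstar 𝔯) 𝔈)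
    (hC_opsYOfLetters N θ.toStage3Params Mstar (lettersYOfRecordDE N θ.toStage3Params Mstar 𝔯) 𝔈) (hGA_e_opsYOfLetters N θ.toStage3Params Mstar (lettersYOfRecordDE N θ.toStage3Params Mstar 𝔯) 𝔈)
    (hGA_h1_opsYOfLetters N θ.toStage3Params Mstar (lettersYOfRecordDE N θ.toStage3Params Mstar 𝔯) 𝔈) (hGA_e4_opsYOfLetters N θ.toStage3Params Mstar (lettersYOfRecordDE N θ.toStage3Params Mstar 𝔯) 𝔈)
    (hGA_h2_opsYOfLetters N θ.toStage3Params Mstar (lettersYOfRecordDE N θ.toStage3Params Mstar 𝔯) 𝔈) (hGA_l2_opsYOfLetters N θ.toStage3Params Mstar (lettersYOfRecordDE N θ.toStage3Params Mstar 𝔯) 𝔈)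
    hE4 hH2 hGp hGA hB hg t37 c38 t39 t310 hsum hksum t311 t312 t313 t314 t315 s349 s3132 t314loc P

end Pointed

end Summit.QuantumFields.YangMills.BalabanUVNodes.N06AtOpsYOfRecordDESound

end
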